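import Literature.Probability.Percolation.OneArmArcCouplingAssembly
import Literature.Probability.Percolation.OneArmAnnulusCrossingFromTrace
import HarnessLib

/-!
# LSW's renewal identity (2.10) for the arc hulls at the joint subsequential limits, as the one
# remaining named input of the one-arm cone

Topic `Literature/Probability/Percolation`; family `crit-perc`. Decomposition file (librarian,
fact-decompose, 2026-08-16) for the named fact `LawlerSchrammWerner2002_annulusCrossing`
(`OneArmLSW.lean`; G. F. Lawler, O. Schramm, W. Werner, *One-arm exponent for critical 2D
percolation*, Electron. J. Probab. 7 (2002), no. 2, Thm. 1.2 with (3.1)), which two prove seats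
triaged XL and parked on `LawlerSchrammWerner2002_hittingPDE`.

The tree proves LSW §3 in full and the analytic half of §2, and its def-free assemblies
(`OneArmArcCouplingAssembly.lean`, `OneArmAnnulusCrossingFromTrace.lean`,
`OneArmAnnulusCrossingFromCoupling.lean`) reduce ALL FOUR continuum statements of the cone —
`LawlerSchrammWerner2002_annulusCrossing`, `LawlerSchrammWerner2002_hittingPDE`,
`LawlerSchrammWerner2002_scalingLimitExponent` (Thm. 1.2) and `oneArm_exponent` (Thm. 1.1) — to ONE
hypothesis, written out verbatim as `h210` in `oneArm_exponent_of_pairLimit_renewal`: LSW's renewal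
identity (2.10) `h(θ, t) = E[h(Y_T^θ, t - T)]` for the law of the conformal radius of the arc hull
`Q(θ)` at every joint subsequential weak limit of the laws of `(Q_δ(θ), Q_δ(2π))` — their
Theorem 2.1 (Smirnov's `SLE₆` description of `Q(θ)`) read through the radial Loewner equation
(2.5)–(2.9). Every other input is a theorem of the tree, so the decomposition of the parent has
exactly ONE child (no second unproved input exists to name); the child is a statement about
continuum objects (weak limits on the Hausdorff space, the radial Bessel renewal `renewalST 6`),
not a restatement of the parent (bounds on discrete annulus-crossing probabilities). Note that the
parent's previous blocker `LawlerSchrammWerner2002_hittingPDE` quantifies over FULL scaling limits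
`Tendsto lswLaw atTop (𝓝 ν)` and yields the parent only together with the existence of that limit
(`LawlerSchrammWerner2002_annulusCrossing_of_scalingLimit_of_hittingPDE`), which is deliberately
not a named fact of this library (`OneArmScalingLimitConnection.lean`); the child below needs no
full scaling limit and discharges `LawlerSchrammWerner2002_hittingPDE` as well.

## Child (named fact introduced here)

* `LawlerSchrammWerner2002_arcHull_renewal` — LSW 2002, Thm. 2.1 with (2.5)–(2.10).

## Main results (all proved)

* `LawlerSchrammWerner2002_annulusCrossing_holds_of : child → LawlerSchrammWerner2002_annulusCrossing`;
* `LawlerSchrammWerner2002_hittingPDE_holds_of`, `LawlerSchrammWerner2002_scalingLimitExponent_holds_of`,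
  `oneArm_exponent_holds_of` — the other three facts of the cone from the same child.

## Mathlib / tree search

Tree (all used): `lswHit_two_pi_eq_measureReal_of_pairLimit_renewal`,
`oneArm_exponent_of_pairLimit_renewal` (`OneArmArcCouplingAssembly.lean`),
`LawlerSchrammWerner2002_annulusCrossing_of_subseqTrace` (`OneArmAnnulusCrossingFromTrace.lean`).
`lean search 'pairLimit_renewal'`: only those theorems; no named fact states (2.10) (2026-08-16).

## References

* G. F. Lawler, O. Schramm, W. Werner, *One-arm exponent for critical 2D percolation*, Electron.
  J. Probab. 7 (2002), no. 2: Thm. 1.1, Thm. 1.2 (p. 2), §2: Thm. 2.1 (p. 3), (2.2), (2.5)–(2.10)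
  (pp. 4–5), Lemma 2.2, Lemma 2.3, §3 (3.1) (p. 8). [LawlerSchrammWernerEJP2002]
* S. Smirnov, *Critical percolation in the plane*, C. R. Acad. Sci. Paris 333 (2001) 239–244
  (LSW's [22]). [SmirnovCRAS2001]
-/

noncomputable section

open MeasureTheory Filter Topology Metric Set TopologicalSpace Complex
open Literature.Probability.LatticeModels Literature.Analysis.Complex
  Literature.Probability.RandomPlanarGeometry Literature.Probability.RandomPlanarGeometry.RadialLoewner

namespace Literature.Probability.Percolation

/-- NAMED FACT — **Lawler–Schramm–Werner 2002, the renewal identity (2.10) for the arc hulls, at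
the joint subsequential scaling limits** (§2, pp. 3–5: Thm. 2.1 (Smirnov) "the law of `Q(θ)` …",
the radial Loewner parametrisation (2.5)–(2.6), `𝔯(θ) = e^{-T}` and `Y_T ∈ {0, 2π}` at the
disconnection time (2.7)–(2.9), whence (2.10) "`h(θ, t) = E[h(Y_T^θ, t - T)]`" with
`h(θ, t) = P[𝔯(θ) ≤ e^{-t}]` (2.2), `h(0, ·) = 1_{· ≤ 0}` by (2.3)). On the tree's carriers: for
every `θ ∈ (0, 2π)`, every sequence `R_k → ∞` of inverse meshes and every weak limit `μ` of the
joint laws `lswPairLaw (R_k) θ` of the pairs `(Q_{1/R_k}(θ), Q_{1/R_k}(2π))` of arc hull and full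
hull (`OneArmArcHulls.lean`), the distribution function of `-log 𝔯` of the first coordinate is
the radial-Bessel renewal extension (`renewalST 6`, `RadialBesselRenewal.lean`: LSW's
`E^θ[V(t - T); Y_T = 0] + E^θ[U(t - T); Y_T = 2π]` for the radial Bessel process `Y` of `SLE₆`)
of the bottom datum `1_{≤ 0}` and of the distribution function of `-log 𝔯` of the second
coordinate: `μ{𝔯(K_θ) ≤ e^{-s}} = renewalST 6 1_{≤0} (s ↦ μ{𝔯(K_{2π}) ≤ e^{-s}}) θ s` for all
`s`. This is the hypothesis `h210` of the tree's `oneArm_exponent_of_pairLimit_renewal`, verbatim.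
Its printed proof is Smirnov's theorem (convergence of the exploration path to `SLE₆`, the tree's
`convergesInLawToSLE_six_triInterface`) with the locality / chordal–radial equivalence of `SLE₆`
up to the disconnection time ([13, Thm. 4.1]) and Itô calculus for the radial Loewner chain.
Users take `(h : LawlerSchrammWerner2002_arcHull_renewal)`.
[cite: LawlerSchrammWernerEJP2002, Thm. 2.1 (p. 3) and §2 (2.2)–(2.10) (pp. 4–5)] -/
def LawlerSchrammWerner2002_arcHull_renewal : Prop :=
  ∀ (θ : ℝ) (R : ℕ → ℝ) (μ : ProbabilityMeasure (NonemptyCompacts ℂ × NonemptyCompacts ℂ)),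
    θ ∈ Ioo 0 (2 * Real.pi) → Tendsto R atTop atTop →
    Tendsto (fun k ↦ lswPairLaw (R k) θ) atTop (𝓝 μ) →
    ∀ s : ℝ, (μ : Measure (NonemptyCompacts ℂ × NonemptyCompacts ℂ)).real
        {p | conformalRadius ((p.1 : NonemptyCompacts ℂ) : Set ℂ) ≤ Real.exp (-s)} =
      renewalST 6 bottomDatum (fun s ↦ (μ : Measure (NonemptyCompacts ℂ × NonemptyCompacts ℂ)).real
        {p | conformalRadius ((p.2 : NonemptyCompacts ℂ) : Set ℂ) ≤ Real.exp (-s)}) θ s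

/-- **LSW 2002, Thm. 1.2 with (3.1) (`LawlerSchrammWerner2002_annulusCrossing`) from the renewal
identity (2.10) at the joint subsequential limits**: the trace identification
`u(2π, t) = ν{𝔯 ≤ e^{-t}}` at every subsequential weak limit of `lswLaw`
(`lswHit_two_pi_eq_measureReal_of_pairLimit_renewal`), then
`LawlerSchrammWerner2002_annulusCrossing_of_subseqTrace` (§3 with the analytic half of §2, proved).
[cite: LawlerSchrammWernerEJP2002, Thm. 1.2 (p. 2), §2 (2.10), §3 (3.1) (p. 8)] -/
theorem LawlerSchrammWerner2002_annulusCrossing_holds_of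
    (h : LawlerSchrammWerner2002_arcHull_renewal) : LawlerSchrammWerner2002_annulusCrossing :=
  LawlerSchrammWerner2002_annulusCrossing_of_subseqTrace fun _ _ hR hν _ ht ↦
    lswHit_two_pi_eq_measureReal_of_pairLimit_renewal h hR hν ht

/-- **LSW 2002, §2: the hitting function and its PDE (`LawlerSchrammWerner2002_hittingPDE`) from
(2.10) at the joint subsequential limits** (`oneArm_exponent_of_pairLimit_renewal`, first
component). [cite: LawlerSchrammWernerEJP2002, §2: (2.2)–(2.4), (2.10), Lemma 2.2, Lemma 2.3] -/
theorem LawlerSchrammWerner2002_hittingPDE_holds_of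
    (h : LawlerSchrammWerner2002_arcHull_renewal) : LawlerSchrammWerner2002_hittingPDE :=
  (oneArm_exponent_of_pairLimit_renewal h).1

/-- **LSW 2002, Thm. 1.2 (`LawlerSchrammWerner2002_scalingLimitExponent`) from (2.10) at the joint
subsequential limits** (`oneArm_exponent_of_pairLimit_renewal`, second component).
[cite: LawlerSchrammWernerEJP2002, Thm. 1.2 (p. 2), §2] -/
theorem LawlerSchrammWerner2002_scalingLimitExponent_holds_of
    (h : LawlerSchrammWerner2002_arcHull_renewal) : LawlerSchrammWerner2002_scalingLimitExponent :=
  (oneArm_exponent_of_pairLimit_renewal h).2.1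

/-- **LSW 2002, Thm. 1.1 — the one-arm exponent `5/48` (`oneArm_exponent`) — from (2.10) at the
joint subsequential limits** (`oneArm_exponent_of_pairLimit_renewal`, third component).
[cite: LawlerSchrammWernerEJP2002, Thm. 1.1 (p. 2), §2–§3] -/
theorem oneArm_exponent_holds_of (h : LawlerSchrammWerner2002_arcHull_renewal) : oneArm_exponent :=
  (oneArm_exponent_of_pairLimit_renewal h).2.2

end Literature.Probability.Percolation

end
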